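import Literature.Analysis.FluidPDE.StatisticalSolutionEnergyEq
import Literature.Analysis.FluidPDE.StatisticalSolutionProofs
import HarnessLib

/-!
# Stub `stub_floorDuality` (W) of line `floor_duality_galerkin` (crux stmt-AnomalousDissipation-18400,
  `TameRoughRigidity.GPEulerCoercive`) — weak duality for the enstrophy floor

The crux N = `GPEulerCoercive` says that no Borel probability measure on `H = L²_σ(T³)` is a
stationary statistical solution (Foias–Manley–Rosa–Temam class: finite mean enstrophy, cylindrical
Liouville identity, shell energy inequality) of the EULER equations (`ν = 0`) forced by the
Galloway–Proctor force. The line `floor_duality_galerkin` reduces N to an unbounded ladder of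
ENSTROPHY-FLOOR CERTIFICATES: pointwise inequalities

  `Γ ≤ ‖∇v‖² + ⟨f − B(v,v), Ψ'(v)⟩`   at every finite-enstrophy `v ∈ H`,

for a cylindrical test functional `Ψ` and a level `Γ`. This file proves the weak-duality step W:
such a certificate, integrated against a stationary statistical solution `μ` of forced Euler,
gives `Γ ≤ ∫ ‖∇v‖² dμ = ensembleEnstrophy μ` (in `ℝ≥0∞`, as `ENNReal.ofReal Γ ≤ ensembleEnstrophy μ`).

## Proof

`μ` is a probability measure (`hμ.prob`) with finite mean enstrophy (`hμ.enstrophy_finite`, which is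
literally `ensembleEnstrophy μ < ⊤`), so the spectral enstrophy density `v ↦ ‖∇v‖²`
(`Torus.eGradNormSq`, Borel measurable on `H` by `Torus.measurable_eGradNormSq_coe`) is finite
`μ`-a.e., its real part is integrable, and `∫ (‖∇v‖²).toReal dμ = (ensembleEnstrophy μ).toReal`
(`integral_toReal`). The stationary Liouville identity (`hμ.generator Ψ`) says the generator pairing
`v ↦ ⟨f − B(v,v), Ψ'(v)⟩` is integrable with integral `0`. The certificate holds `μ`-a.e. (wherever
the enstrophy is finite), so `integral_mono_ae` gives
`Γ = ∫ Γ dμ ≤ ∫ (‖∇v‖²).toReal dμ + ∫ ⟨f − B(v,v), Ψ'(v)⟩ dμ = (ensembleEnstrophy μ).toReal + 0`,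
and `ENNReal.ofReal_le_of_le_toReal` converts this to the `ℝ≥0∞` statement (no sign case on `Γ`).
No compactness and no sign of the shell work is used.

## References

* C. Foias, O. Manley, R. Rosa, R. Temam, *Navier–Stokes Equations and Turbulence* (CUP 2001),
  Ch. IV §1.2 Def. 1.3, (1.29)–(1.31) (stationary statistical solutions; finite mean enstrophy and
  the Liouville identity).
* R. Rosa, R. Temam, arXiv:2010.06730 (auxiliary functionals / minimax for statistical solutions —
  the weak-duality direction used here).
-/

-- `Summit.<Summit>.<Problem>` is the tree's mandated summit-side namespace (CONVENTIONS §2); single-conjunct summit, duplicate deliberate.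
set_option linter.dupNamespace false

noncomputable section

namespace Summit.AnomalousDissipation.AnomalousDissipation.Theorems.TameRoughRigidity.GPEulerCoercive

open MeasureTheory Filter Topology UnitAddTorus
open scoped InnerProductSpace RealInnerProductSpace ENNReal NNReal
open Literature.Analysis.FunctionSpaces Literature.Analysis.FluidPDE

/-- Local notation: real vector fields on `T³`. -/
local notation "Vec3" => (UnitAddTorus (Fin 3)) → (EuclideanSpace ℝ (Fin 3))
/-- Local notation: `L²(T³; ℝ³)`. -/
local notation "L2" => (Lp (EuclideanSpace ℝ (Fin 3)) 2 (volume : Measure (UnitAddTorus (Fin 3))))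
/-- Local notation: the energy space `H`. -/
local notation "H3" => (Torus.energySpace (Fin 3))

/-- **W `stub_floorDuality`** — WEAK DUALITY FOR THE ENSTROPHY FLOOR. A stationary statistical
solution `μ` of Euler forced by `f` kills every cylindrical generator image
(`IsStationaryStatisticalSolution.generator`: integrable, integral zero) and has the integrable,
a.e.-finite enstrophy density `v ↦ ‖∇v‖²` of integral `(ensembleEnstrophy μ).toReal`; integrating
the pointwise floor certificate `Γ ≤ ‖∇v‖² + ⟨f − B(v,v), Ψ'(v)⟩` (valid at finite-enstrophy `v`,
i.e. `μ`-a.e.) gives `Γ ≤ ∫ ‖∇v‖² dμ`, i.e. `ENNReal.ofReal Γ ≤ ensembleEnstrophy μ`.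
No compactness, no sign of the shell work is used. [folklore] -/
theorem stub_floorDuality (f : Vec3) (μ : Measure H3) (Ψ : Torus.CylindricalTest (Fin 3)) (Γ : ℝ)
    (hμ : Torus.IsStationaryStatisticalSolution 0 f μ)
    (hcert : ∀ v : H3, Torus.eGradNormSq ((v : L2) : Vec3) ≠ ⊤ →
      Γ ≤ (Torus.eGradNormSq ((v : L2) : Vec3)).toReal + Torus.nsGeneratorPairing 0 f v (Ψ.grad v)) :
    ENNReal.ofReal Γ ≤ Torus.ensembleEnstrophy μ := by
  haveI := hμ.prob
  -- (1) the enstrophy density: measurable, finite a.e., integrable, of integral `G`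
  have hGfin : Torus.ensembleEnstrophy μ < ⊤ := hμ.enstrophy_finite
  have hGm : Measurable fun u : H3 => Torus.eGradNormSq ((u : L2) : Vec3) :=
    Torus.measurable_eGradNormSq_coe
  have hGlt : ∀ᵐ u : H3 ∂μ, Torus.eGradNormSq ((u : L2) : Vec3) < ⊤ := ae_lt_top hGm hGfin.ne
  have haI : Integrable (fun u : H3 => (Torus.eGradNormSq ((u : L2) : Vec3)).toReal) μ :=
    integrable_toReal_of_lintegral_ne_top hGm.aemeasurable hGfin.ne
  have hGa : ∫ u : H3, (Torus.eGradNormSq ((u : L2) : Vec3)).toReal ∂μ =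
      (Torus.ensembleEnstrophy μ).toReal := by
    rw [Torus.ensembleEnstrophy, integral_toReal hGm.aemeasurable hGlt]
  -- (2) the stationary Liouville identity for `Ψ`
  obtain ⟨hgenI, hgen0⟩ := hμ.generator Ψ
  -- (3) integrate the pointwise certificate inequality (valid `μ`-a.e.)
  have hae : ∀ᵐ v : H3 ∂μ,
      Γ ≤ (Torus.eGradNormSq ((v : L2) : Vec3)).toReal + Torus.nsGeneratorPairing 0 f v (Ψ.grad v) := by
    filter_upwards [hGlt] with v hv
    exact hcert v hv.ne
  have hRI : Integrable (fun v : H3 =>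
      (Torus.eGradNormSq ((v : L2) : Vec3)).toReal + Torus.nsGeneratorPairing 0 f v (Ψ.grad v)) μ :=
    haI.add hgenI
  have hmono := integral_mono_ae (integrable_const Γ) hRI hae
  rw [integral_const, probReal_univ, one_smul, integral_add haI hgenI, hgen0, add_zero, hGa] at hmono
  -- (4) back to `ℝ≥0∞`
  exact ENNReal.ofReal_le_of_le_toReal hmono

end Summit.AnomalousDissipation.AnomalousDissipation.Theorems.TameRoughRigidity.GPEulerCoercive

end
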